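import Summits.BirchSwinnertonDyer.BirchSwinnertonDyer.Theorems.EisensteinPrimesFullDescentTateAlgebraThree
import HarnessLib

/-!
# Crux `GoodLatticeBDPValue` (stmt-BirchSwinnertonDyer-19032), line `halves`, AN-3 Stub B road — brick F1 (sequel):
# the level-9 ALGEBRA of a Tate basis (pure group theory, no field)

Width seat bsd-line-x1-p1-w3 (gen 4). HONEST FRAMING (cell `bsd-eis`): TOOL THEOREMS ONLY (no `def`, no
named fact, no `sorry`); nothing about a curve, a summit statement, Keller–Yin Thm. 2.2.2 or crux 2 is
proved here; 0 stubs / cells / labels move. Sequel of `…FullDescentTateAlgebraThree` (same namespace,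
same Tate-basis hypotheses = the output shape of
`Literature.NumberTheory.EllipticCurves.TateCurve.exists_basis_of_uniformization` at `N = 9`); road memo
`HOME/line-x1-p1-w3-g4/AN3-StubB-elementary-road.md` (evidence #44 on the item), steps A2/A3:

* **`smul_sub_mem_zmultiples_of_nine`** (T-d) — `σ` with `9 ∣ χ σ − 1` (inertia at `ℓ ≠ 3`) acts
  trivially on `3⁻¹(ℤ•3P₁) / (ℤ•3P₁)`, with NO condition on `κ` («`q″ = q³` is a cube»);
* `addOrderOf_fst_eq_nine`;
* **`eq_zmultiples_fst_of_stable_nine`** (T-c) — a `σ₀`-stable subgroup `L` of order `9` (`σ₀` with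
  `3 ∤ χ σ₀ − 1`, i.e. `ζ₃ ∉ ℚ_ℓ`) whose `3`-torsion lies in `ℤ • 3P₁` IS `ℤ • P₁ = Ψ(μ₉)` — so `G_ℓ`
  acts on the global cyclic `9`-line of the memo through `χ = ε mod 9`, and its inertia trivially.

References: [SilvermanATAEC1994] J. H. Silverman, *Advanced Topics in the Arithmetic of Elliptic Curves*,
GTM 151, Ch. V Thm. 3.1 (c),(d), Lemma 5.2 (c), Thm. 5.3; [SerreInventiones1972] J.-P. Serre,
Invent. Math. 15 (1972) §1.12.
-/

set_option autoImplicit false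
set_option linter.dupNamespace false

namespace Summit.BirchSwinnertonDyer.BirchSwinnertonDyer.Theorems.FullDescentTateAlgebra

variable {G M : Type*} [Group G] [AddCommGroup M] [DistribMulAction G M]

/-! ## §3. Level 9 -/

section Nine

variable {P₁ P₂ : M} {χ κ : G → ℤ}

/-- **(T-d) Inertia acts trivially on `3⁻¹C / C`, `C = ℤ • 3P₁`** (memo A2: no condition on `κ`, i.e.
on `q` — «`q″ = q³` is a cube»): if `9 ∣ χ(σ) − 1` and `x` is a `9`-torsion element with `3x ∈ ℤ • 3P₁`,
then `σ x − x ∈ ℤ • 3P₁`. [cite: SilvermanATAEC1994, Lemma V.5.2] -/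
theorem smul_sub_mem_zmultiples_of_nine
    (hgen : ∀ P : M, (9 : ℤ) • P = 0 → ∃ a b : ℤ, P = a • P₁ + b • P₂)
    (hrel : ∀ a b : ℤ, a • P₁ + b • P₂ = 0 ↔ (9 : ℤ) ∣ a ∧ (9 : ℤ) ∣ b)
    (hP₁ : ∀ σ : G, σ • P₁ = χ σ • P₁) (hP₂ : ∀ σ : G, σ • P₂ = P₂ + κ σ • P₁)
    {σ : G} (hχσ : (9 : ℤ) ∣ χ σ - 1) {x : M} (hx9 : (9 : ℤ) • x = 0)
    (hx3 : (3 : ℤ) • x ∈ AddSubgroup.zmultiples ((3 : ℤ) • P₁)) :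
    σ • x - x ∈ AddSubgroup.zmultiples ((3 : ℤ) • P₁) := by
  have hrel' : ∀ a b : ℤ, a • P₁ + b • P₂ = 0 ↔ ((9 : ℕ) : ℤ) ∣ a ∧ ((9 : ℕ) : ℤ) ∣ b := by
    simpa using hrel
  obtain ⟨a, b, rfl⟩ := hgen x hx9
  obtain ⟨m, hm⟩ := AddSubgroup.mem_zmultiples_iff.mp hx3
  -- `3x = 3m P₁` gives `9 ∣ 3b`, i.e. `3 ∣ b`
  have hb : (3 : ℤ) ∣ b := by
    have h : (3 * a) • P₁ + (3 * b) • P₂ = (3 * m) • P₁ + (0 : ℤ) • P₂ := by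
      rw [show (3 * a) • P₁ + (3 * b) • P₂ = (3 : ℤ) • (a • P₁ + b • P₂) by module, ← hm]; module
    have h' := ((comb_eq_comb_iff hrel' _ _ _ _).mp h).2
    simp only [Nat.cast_ofNat, sub_zero] at h'
    omega
  obtain ⟨t, ht⟩ := hχσ
  obtain ⟨b', hb'⟩ := hb
  refine AddSubgroup.mem_zmultiples_iff.mpr ⟨3 * a * t + b' * κ σ, ?_⟩
  rw [smul_comb hP₁ hP₂, show χ σ = 9 * t + 1 by omega, hb']
  module

/-- The element `P₁` of a level-9 Tate basis has additive order `9`. [folklore] -/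
theorem addOrderOf_fst_eq_nine
    (hrel : ∀ a b : ℤ, a • P₁ + b • P₂ = 0 ↔ (9 : ℤ) ∣ a ∧ (9 : ℤ) ∣ b) : addOrderOf P₁ = 9 := by
  haveI : Fact (Nat.Prime 3) := ⟨Nat.prime_three⟩
  have h9 : (3 : ℕ) ^ (1 + 1) • P₁ = 0 := by
    have h := (hrel 9 0).mpr ⟨dvd_rfl, dvd_zero _⟩
    rw [← natCast_zsmul]
    simpa using h
  have h3 : ¬ (3 : ℕ) ^ 1 • P₁ = 0 := by
    intro h0
    have h : (3 : ℤ) • P₁ + (0 : ℤ) • P₂ = 0 := by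
      rw [← natCast_zsmul] at h0; simpa using h0
    have := ((hrel 3 0).mp h).1
    omega
  have := addOrderOf_eq_prime_pow h3 h9
  simpa using this

/-- **(T-c) The unique stable cyclic group of order `9` over the Tate line is `Ψ(μ₉)`** (memo A3).
Let `L` be a subgroup of order `9` of `9`-torsion elements, stable under some `σ₀` with
`3 ∤ χ(σ₀) − 1` (`ζ₃ ∉ ℚ_ℓ`), whose `3`-torsion lies in `ℤ • 3P₁`. Then `L = ℤ • P₁`: `L` is generated by
some `x = aP₁ + bP₂` of order `9` with `3 ∣ b`, `3 ∤ a`; `σ₀ x = m x` forces `m ≡ χ(σ₀) (mod 3)` and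
`9 ∣ b (1 − m)`, so `9 ∣ b`. [cite: SilvermanATAEC1994, Lemma V.5.2] -/
theorem eq_zmultiples_fst_of_stable_nine
    (hgen : ∀ P : M, (9 : ℤ) • P = 0 → ∃ a b : ℤ, P = a • P₁ + b • P₂)
    (hrel : ∀ a b : ℤ, a • P₁ + b • P₂ = 0 ↔ (9 : ℤ) ∣ a ∧ (9 : ℤ) ∣ b)
    (hP₁ : ∀ σ : G, σ • P₁ = χ σ • P₁) (hP₂ : ∀ σ : G, σ • P₂ = P₂ + κ σ • P₁)
    {σ₀ : G} (hσ₀ : ¬ (3 : ℤ) ∣ χ σ₀ - 1) {L : AddSubgroup M} (hL : Nat.card L = 9)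
    (hL9 : ∀ x ∈ L, (9 : ℤ) • x = 0) (hst : ∀ x ∈ L, σ₀ • x ∈ L)
    (hL3 : ∀ x ∈ L, (3 : ℤ) • x = 0 → x ∈ AddSubgroup.zmultiples ((3 : ℤ) • P₁)) :
    L = AddSubgroup.zmultiples P₁ := by
  haveI : Fact (Nat.Prime 3) := ⟨Nat.prime_three⟩
  have hrel' : ∀ a b : ℤ, a • P₁ + b • P₂ = 0 ↔ ((9 : ℕ) : ℤ) ∣ a ∧ ((9 : ℕ) : ℤ) ∣ b := by
    simpa using hrel
  haveI hLfin : Finite L := Nat.finite_of_card_ne_zero (by rw [hL]; norm_num)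
  -- the order of `P₁` and of `3P₁`
  have hordP₁ : addOrderOf P₁ = 9 := addOrderOf_fst_eq_nine hrel
  have h3P₁0 : (3 : ℤ) • P₁ ≠ 0 := by
    intro h0
    have := ((hrel 3 0).mp (by simpa using h0)).1
    omega
  have hord3 : addOrderOf ((3 : ℤ) • P₁) = 3 := by
    refine addOrderOf_eq_prime ?_ h3P₁0
    rw [← natCast_zsmul, smul_smul]
    have h := (hrel 9 0).mpr ⟨dvd_rfl, dvd_zero _⟩
    simpa using h
  -- `L` has an element `x` with `3x ≠ 0` (else `L ≤ ℤ•3P₁`, of order `3 < 9`)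
  obtain ⟨x, hxL, hx3⟩ : ∃ x ∈ L, (3 : ℤ) • x ≠ 0 := by
    by_contra! hall
    have hle : L ≤ AddSubgroup.zmultiples ((3 : ℤ) • P₁) := fun y hy ↦ hL3 y hy (hall y hy)
    haveI : Finite (AddSubgroup.zmultiples ((3 : ℤ) • P₁)) :=
      Nat.finite_of_card_ne_zero (by rw [Nat.card_zmultiples, hord3]; norm_num)
    have hcard := AddSubgroup.card_le_of_le hle
    rw [hL, Nat.card_zmultiples, hord3] at hcard
    omega
  -- `x = aP₁ + bP₂` with `3 ∣ b` and `3 ∤ a`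
  obtain ⟨a, b, rfl⟩ := hgen x (hL9 x hxL)
  have hx3mem : (3 : ℤ) • (a • P₁ + b • P₂) ∈ AddSubgroup.zmultiples ((3 : ℤ) • P₁) :=
    hL3 _ (L.zsmul_mem hxL 3) (by rw [smul_smul, show (3 : ℤ) * 3 = 9 by norm_num]; exact hL9 _ hxL)
  obtain ⟨m, hm⟩ := AddSubgroup.mem_zmultiples_iff.mp hx3mem
  have hab : (9 : ℤ) ∣ 3 * a - 3 * m ∧ (9 : ℤ) ∣ 3 * b - 0 := by
    have h : (3 * a) • P₁ + (3 * b) • P₂ = (3 * m) • P₁ + (0 : ℤ) • P₂ := by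
      rw [show (3 * a) • P₁ + (3 * b) • P₂ = (3 : ℤ) • (a • P₁ + b • P₂) by module, ← hm]; module
    have h' := (comb_eq_comb_iff hrel' _ _ _ _).mp h
    simpa using h'
  have hb : (3 : ℤ) ∣ b := by omega
  have ha : ¬ (3 : ℤ) ∣ a := by
    intro ha
    apply hx3
    have h : (3 * a) • P₁ + (3 * b) • P₂ = 0 := (hrel _ _).mpr ⟨by omega, by omega⟩
    rw [show (3 : ℤ) • (a • P₁ + b • P₂) = (3 * a) • P₁ + (3 * b) • P₂ by module, h]
  -- `x` has order `9`, so `L = ℤ • x`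
  have hordx : addOrderOf (a • P₁ + b • P₂) = 9 := by
    have h9 : (3 : ℕ) ^ (1 + 1) • (a • P₁ + b • P₂) = 0 := by
      rw [show (3 : ℕ) ^ (1 + 1) = 9 by norm_num, ← natCast_zsmul, Nat.cast_ofNat]; exact hL9 _ hxL
    have h3 : ¬ (3 : ℕ) ^ 1 • (a • P₁ + b • P₂) = 0 := by
      rw [pow_one, ← natCast_zsmul, Nat.cast_ofNat]; exact hx3
    simpa using addOrderOf_eq_prime_pow h3 h9
  have hLx : L = AddSubgroup.zmultiples (a • P₁ + b • P₂) := by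
    haveI : Finite (AddSubgroup.zmultiples (a • P₁ + b • P₂)) :=
      Nat.finite_of_card_ne_zero (by rw [Nat.card_zmultiples, hordx]; norm_num)
    refine (AddSubgroup.eq_of_le_of_card_ge (AddSubgroup.zmultiples_le.mpr hxL) ?_).symm
    rw [hL, Nat.card_zmultiples, hordx]
  -- `σ₀ x = m' x`
  have hσx : σ₀ • (a • P₁ + b • P₂) ∈ AddSubgroup.zmultiples (a • P₁ + b • P₂) := by
    rw [← hLx]; exact hst _ hxL
  obtain ⟨m', hm'⟩ := AddSubgroup.mem_zmultiples_iff.mp hσx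
  rw [smul_comb hP₁ hP₂] at hm'
  have hcoef := (comb_eq_comb_iff hrel' _ _ _ _).mp (by rw [← hm']; module :
    (m' * a) • P₁ + (m' * b) • P₂ = (a * χ σ₀ + b * κ σ₀) • P₁ + b • P₂)
  simp only [Nat.cast_ofNat] at hcoef
  obtain ⟨h1, h2⟩ := hcoef
  -- mod 3: `3 ∣ a (m' - χ σ₀)` hence `3 ∣ m' - χ σ₀`, so `3 ∤ m' - 1`
  obtain ⟨b', rfl⟩ := hb
  have h1' : (3 : ℤ) ∣ a * (m' - χ σ₀) := by
    have h13 : (3 : ℤ) ∣ m' * a - (a * χ σ₀ + 3 * b' * κ σ₀) := (Int.dvd_of_emod_eq_zero (by omega))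
    have e : a * (m' - χ σ₀) = (m' * a - (a * χ σ₀ + 3 * b' * κ σ₀)) + 3 * (b' * κ σ₀) := by ring
    rw [e]
    exact dvd_add h13 (dvd_mul_right 3 _)
  have hmχ : (3 : ℤ) ∣ m' - χ σ₀ := by
    rcases Int.prime_three.dvd_or_dvd h1' with h | h
    · exact absurd h ha
    · exact h
  have hm1 : ¬ (3 : ℤ) ∣ m' - 1 := by
    intro h
    apply hσ₀
    have e : χ σ₀ - 1 = (m' - 1) - (m' - χ σ₀) := by ring
    rw [e]
    exact dvd_sub h hmχ
  -- `9 ∣ 3b'(m' - 1)` hence `3 ∣ b'`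
  have hb'9 : (3 : ℤ) ∣ b' * (m' - 1) := by
    have e : m' * (3 * b') - 3 * b' = 3 * (b' * (m' - 1)) := by ring
    rw [e] at h2
    omega
  have hb' : (3 : ℤ) ∣ b' := by
    rcases Int.prime_three.dvd_or_dvd hb'9 with h | h
    · exact h
    · exact absurd h hm1
  -- so `x = a P₁` and `L = ℤ • aP₁ ≤ ℤ • P₁`; equal orders finish
  obtain ⟨b'', rfl⟩ := hb'
  have hx' : a • P₁ + (3 * (3 * b'')) • P₂ = a • P₁ := by
    have h := (comb_eq_comb_iff hrel' a (3 * (3 * b'')) a 0).mpr ⟨by simp, by simp; ring_nf; omega⟩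
    simpa using h
  rw [hx'] at hLx
  have hle : L ≤ AddSubgroup.zmultiples P₁ := by
    rw [hLx, AddSubgroup.zmultiples_le]
    exact AddSubgroup.zsmul_mem_zmultiples P₁ a
  haveI : Finite (AddSubgroup.zmultiples P₁) :=
    Nat.finite_of_card_ne_zero (by rw [Nat.card_zmultiples, hordP₁]; norm_num)
  exact AddSubgroup.eq_of_le_of_card_ge hle (by rw [hL, Nat.card_zmultiples, hordP₁])

end Nine

end Summit.BirchSwinnertonDyer.BirchSwinnertonDyer.Theorems.FullDescentTateAlgebra
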